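import Summits.AnomalousDissipation.AnomalousDissipation.Theorems.SolenoidalFractalHomogenisationLagrangianCarrierConstructionRegularLSupBound
import Summits.AnomalousDissipation.AnomalousDissipation.Theorems.SolenoidalFractalHomogenisationLagrangianCarrierConstructionTowerWindows
import Literature.Analysis.FluidPDE.LagrangianLatticeCarrierFrame
import Literature.Analysis.ODE.TorusFlowFrameRegularityHigher
import Literature.Analysis.ODE.TorusFlowGradDnormWithin
import HarnessLib

/-!
# Analytic tower of a Lagrangian lattice carrier, II: analyticity seminorms of the WINDOW FLOW GRADIENTS, forward and
# backward (helper for K1L_D `stmt-AnomalousDissipation-27980`, W3-E (ii) `stub_effectiveFrameEnergyL_bandKill`; `--supports`)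

Summits-side helper file (everything proved; no definitions, no named facts). For an abstract Lagrangian lattice carrier `E`
with the qualitative package `LevelRegular` and the flow equation `IsFlow m`, on the refresh window of level `m+1` with left end
`w = j · refresh (m+1)` and a window time `s` (`0 ≤ s < refresh (m+1)`): IF the coarse field has Armstrong–Vicol seminorms
`⟦b_{≤m}(t)⟧_{n,R_f} ≤ C_f` (`1 ≤ n ≤ N`, all `t`) and `s ≤ 1/(12 C_f R_f)`, THEN
* (forward, §2) every Jacobian entry of the window flow `X_m(w+s, w)` satisfies `⟦(∇X)_{ac}⟧_{n, 24R_f(1+24C_fR_f s)} ≤ 18`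
  (`1 ≤ n ≤ N−1`) and `|∂_c D_a| ≤ 24 C_f R_f s` (`dnorm_flowDeriv_entry_le_forward`, `abs_partialDeriv_disp_le_forward`);
* (backward, §3) the same for the INVERSE window flow `X_m(w, w+s) = X_m(w+s, w)⁻¹`, i.e. for the displacement
  `disp m w (w+s)` (`dnorm_dispInv_entry_le`, `abs_partialDeriv_dispInv_le`) — it is the forward flow, over the same time `s`, of
  the reversed field `r ↦ −b_{≤m}(w+s−r)`, which has the same seminorms.
Both are Armstrong–Vicol App. A Prop. 7.11 on the window (`TorusFlow.dnorm_flowGrad_le_forward_ofDerivWithin`), fed with the chain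
rule on steroids WITHIN the window (`TorusFlow.hasDerivWithinAt_iterPartialDeriv_disp`, from `IsFlow` + `LevelRegular` — forward data
packaged by `LagrangianLatticeCarrierFrame`, backward data in §1/§3 here: the time-uniform derivative bounds of the backward displacement
come from the group law `Φ(w+s→r) = Φ(w→r) ∘ Φ(w+s→w)` and the window bounds (F1c)). Infrastructure for route-1's rung leaf F-D1.A0 (a
frontier FORMAL rung); NOT a proof of anomalous dissipation.
-/

set_option linter.dupNamespace false

noncomputable section

namespace Summit.AnomalousDissipation.AnomalousDissipation.Theorems.SolenoidalFractalHomogenisation.LagrangianCarrierAnalytic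

open Set Function Filter Topology MeasureTheory intervalIntegral
open scoped ContDiff NNReal
open Literature.Analysis Literature.Analysis.ODE Literature.Analysis.ODE.TorusFlow
open Literature.Analysis.FunctionSpaces Literature.Analysis.FunctionSpaces.Torus
open Literature.Analysis.FluidPDE Literature.Analysis.FluidPDE.LatticeShear
open Summit.AnomalousDissipation.AnomalousDissipation.Theorems.SolenoidalFractalHomogenisation.LagrangianCarrierConstruction
  (lift_disp_eq_evolutionMap_sub isUniformlyLipschitzOn_partialSum_proj exists_bound_of_isLatticePeriodic)

variable {k : ℕ}

/-! ## §0 Tools -/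

/-- **All derivatives of the lift of a smooth torus function are bounded** (continuous and lattice periodic). [folklore] -/
theorem exists_bound_iteratedFDeriv_lift {F : Type*} [NormedAddCommGroup F] [NormedSpace ℝ F]
    {f : UnitAddTorus (Fin 3) → F} (hf : IsSmooth f) (n : ℕ) :
    ∃ C : ℝ, 0 ≤ C ∧ ∀ y, ‖iteratedFDeriv ℝ n (lift f) y‖ ≤ C := by
  have hper : Torus.IsLatticePeriodic (iteratedFDeriv ℝ n (lift f)) := by
    intro j y
    rw [← iteratedFDeriv_comp_add_right]
    congr 1
    funext x
    exact isLatticePeriodic_lift f j x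
  have hc : Continuous (iteratedFDeriv ℝ n (lift f)) :=
    hf.continuous_iteratedFDeriv (m := n) (WithTop.coe_le_coe.2 le_top)
  obtain ⟨C, hC⟩ := exists_bound_of_isLatticePeriodic hper hc
  exact ⟨max C 0, le_max_right _ _, fun y => (hC y).trans (le_max_left _ _)⟩

/-- `disp m s s = 0` (the flow equation at equal times). [cite: ArmstrongVicol2025, §2.2 (PDF p. 18: X_m(s,x,s) = x)] -/
theorem disp_self_of_isFlow (E : LagrangianLatticeCarrier k) {m : ℕ} (hF : E.IsFlow m) (s : ℝ) (x : UnitAddTorus (Fin 3)) :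
    E.disp m s s x = 0 := by
  rw [hF s s x, intervalIntegral.integral_same]

/-- Uniform-in-order packaging: from `∀ n, ∃ C_n` to one constant `C ≥ c₀` for all orders `≤ n`. [folklore] -/
theorem exists_uniform_bound_le {ι : Type*} {P : ι → ℕ → ℝ} (c₀ : ℝ)
    (h : ∀ n : ℕ, ∃ C : ℝ, ∀ t, P t n ≤ C) (n : ℕ) :
    ∃ C : ℝ, c₀ ≤ C ∧ ∀ i, i ≤ n → ∀ t, P t i ≤ C := by
  induction n with
  | zero =>
    obtain ⟨C, hC⟩ := h 0
    exact ⟨max C c₀, le_max_right _ _, fun i hi t => by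
      obtain rfl : i = 0 := Nat.le_zero.mp hi; exact (hC t).trans (le_max_left _ _)⟩
  | succ n ih =>
    obtain ⟨C, hC0, hC⟩ := ih
    obtain ⟨C', hC'⟩ := h (n + 1)
    refine ⟨max C C', le_max_of_le_left hC0, fun i hi t => ?_⟩
    rcases Nat.lt_or_ge i (n + 1) with hlt | hge
    · exact (hC i (Nat.lt_succ_iff.mp hlt) t).trans (le_max_left _ _)
    · obtain rfl : i = n + 1 := le_antisymm hi hge
      exact (hC' t).trans (le_max_right _ _)

/-! ## §1 The three regularity clauses of `LevelRegular` in the shape used here -/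

/-- (L1), (L3a), (L3b), (F1a) as the four arguments of the K3L flow lemmas. [cite: ArmstrongVicol2025, §2.2 (PDF p. 18)] -/
theorem levelRegular_flow_args (E : LagrangianLatticeCarrier k) (hR : E.LevelRegular) :
    (∀ m, Continuous (uncurry (E.b (m + 1)))) ∧ (∀ m t, IsSmooth (E.b (m + 1) t)) ∧
      (∀ m (n : ℕ), ∃ C : ℝ, ∀ t y, ‖iteratedFDeriv ℝ n (Torus.lift (E.b (m + 1) t)) y‖ ≤ C) ∧
      (∀ m s, Continuous fun p : ℝ × UnitAddTorus (Fin 3) => E.disp m p.1 s p.2) :=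
  ⟨hR.continuous_uncurry_b, hR.isSmooth_b, hR.exists_norm_iteratedFDeriv_b_le, hR.continuous_disp⟩

/-! ## §2 The forward window flow `X_m(w+s, w)` -/

/-- **Forward window flow, analyticity of the Jacobian entries** (AV Prop. 7.11 on the refresh window): if
`⟦b_{≤m}(t)⟧_{n,R_f} ≤ C_f` for `1 ≤ n ≤ N` and all `t`, then for `0 ≤ s < refresh (m+1)` with `s ≤ 1/(12 C_f R_f)` and
`1 ≤ n ≤ N − 1`: `⟦y ↦ (flowDeriv m (w+s) w y e_c)_a⟧_{n, 24 R_f (1 + 24 C_f R_f s)} ≤ 18`.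
[cite: ArmstrongVicol2025, App. A Prop. 7.11 ((e.ODE.flow.estimate)); §2.2 (PDF p. 18)] -/
theorem dnorm_flowDeriv_entry_le_forward (E : LagrangianLatticeCarrier k) (hR : E.LevelRegular) {m : ℕ} (hF : E.IsFlow m)
    (j : ℤ) {Cf Rf : ℝ} (hCf : 0 < Cf) (hRf : 0 < Rf) {N : ℕ}
    (hfb : ∀ n, 1 ≤ n → n ≤ N → ∀ t, dnorm n Rf (E.partialSum m t) ≤ Cf)
    {s : ℝ} (hs0 : 0 ≤ s) (hsR : s < E.refresh (m + 1)) (hsT : s ≤ 1 / (12 * Cf * Rf)) :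
    ∀ n, 1 ≤ n → n + 1 ≤ N → ∀ a c : Fin 3,
      dnorm n (24 * Rf * (1 + 24 * Cf * Rf * s))
        (fun y => (E.flowDeriv m ((j : ℝ) * E.refresh (m + 1) + s) ((j : ℝ) * E.refresh (m + 1)) y
          (EuclideanSpace.single c (1 : ℝ))) a) ≤ 18 := by
  intro n hn1 hnN a c
  set w : ℝ := (j : ℝ) * E.refresh (m + 1) with hw
  obtain ⟨hbc, hbs, hbB, -⟩ := hR.window_b_clauses m w s
  obtain ⟨hDc, hDs, hDB⟩ := hR.window_disp_clauses m j hsR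
  have hint : ∀ s' ∈ Icc 0 s, ∀ x, E.disp m (w + s') w x =
      ∫ r in (0 : ℝ)..s', E.partialSum m (w + r) (x + proj (E.disp m (w + r) w x)) := fun s' _ x => hF.window_integral_eq w s' x
  have hDt := hasDerivWithinAt_iterPartialDeriv_disp hbc hbs hbB hDc hDs hDB hint
  have hT₀ : s ≤ 1 / (4 * (Fintype.card (Fin 3) : ℝ) * Cf * Rf) := by
    have e4 : (4 : ℝ) * (Fintype.card (Fin 3) : ℝ) * Cf * Rf = 12 * Cf * Rf := by
      rw [Fintype.card_fin]; push_cast; ring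
    rw [e4]; exact hsT
  have key := dnorm_flowGrad_le_forward_ofDerivWithin (f := fun r => E.partialSum m (w + r)) (D := fun r => E.disp m (w + r) w)
    hCf hRf (fun r => hR.isSmooth_partialSum m _) (fun r => hR.isSmooth_disp m _ _)
    (fun x => by simpa using disp_self_of_isFlow E hF w x) hT₀
    (fun l i x t ht => hDt l i x ht) (fun n hn hnN t => hfb n hn hnN _) n hn1 hnN s ⟨hs0, le_rfl⟩ a c
  simp_rw [hR.flowDeriv_single_apply]
  have e : (24 : ℝ) * Rf * (1 + 24 * Cf * Rf * s) =
      8 * (Fintype.card (Fin 3) : ℝ) * Rf * (1 + 8 * (Fintype.card (Fin 3) : ℝ) * Cf * Rf * s) := by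
    rw [Fintype.card_fin]; norm_num
  rw [e]
  refine key.trans ?_
  rw [Fintype.card_fin]; norm_num

/-- **Forward window flow, first-order distortion** (AV Prop. 7.10 first display): `|∂_c (disp m (w+s) w)_a (y)| ≤ 24 C_f R_f s`.
[cite: ArmstrongVicol2025, App. A Prop. 7.10 (first display); §2.2 (PDF p. 18)] -/
theorem abs_partialDeriv_disp_le_forward (E : LagrangianLatticeCarrier k) (hR : E.LevelRegular) {m : ℕ} (hF : E.IsFlow m)
    (j : ℤ) {Cf Rf : ℝ} (hCf : 0 < Cf) (hRf : 0 < Rf) {N : ℕ} (hN : 1 ≤ N)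
    (hfb : ∀ n, 1 ≤ n → n ≤ N → ∀ t, dnorm n Rf (E.partialSum m t) ≤ Cf)
    {s : ℝ} (hs0 : 0 ≤ s) (hsR : s < E.refresh (m + 1)) (hsT : s ≤ 1 / (12 * Cf * Rf)) (c a : Fin 3) (y : UnitAddTorus (Fin 3)) :
    |partialDeriv c (fun z => E.disp m ((j : ℝ) * E.refresh (m + 1) + s) ((j : ℝ) * E.refresh (m + 1)) z a) y| ≤
      24 * Cf * Rf * s := by
  set w : ℝ := (j : ℝ) * E.refresh (m + 1) with hw
  obtain ⟨hbc, hbs, hbB, -⟩ := hR.window_b_clauses m w s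
  obtain ⟨hDc, hDs, hDB⟩ := hR.window_disp_clauses m j hsR
  have hint : ∀ s' ∈ Icc 0 s, ∀ x, E.disp m (w + s') w x =
      ∫ r in (0 : ℝ)..s', E.partialSum m (w + r) (x + proj (E.disp m (w + r) w x)) := fun s' _ x => hF.window_integral_eq w s' x
  have hDt := hasDerivWithinAt_iterPartialDeriv_disp hbc hbs hbB hDc hDs hDB hint
  have hT₀ : s ≤ 1 / (4 * (Fintype.card (Fin 3) : ℝ) * Cf * Rf) := by
    have e4 : (4 : ℝ) * (Fintype.card (Fin 3) : ℝ) * Cf * Rf = 12 * Cf * Rf := by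
      rw [Fintype.card_fin]; push_cast; ring
    rw [e4]; exact hsT
  have key := abs_partialDeriv_disp_le_forward_ofDerivWithin (f := fun r => E.partialSum m (w + r))
    (D := fun r => E.disp m (w + r) w) hCf hRf hN (fun r => hR.isSmooth_partialSum m _) (fun r => hR.isSmooth_disp m _ _)
    (fun x => by simpa using disp_self_of_isFlow E hF w x) hT₀
    (fun l i x t ht => hDt l i x ht) (fun n hn hnN t => hfb n hn hnN _) (t := s) ⟨hs0, le_rfl⟩ c a y
  refine key.trans (le_of_eq ?_)
  rw [Fintype.card_fin]; norm_num

/-! ## §3 The backward window flow `X_m(w, w+s) = X_m(w+s, w)⁻¹` -/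

/-- The backward displacement solves the flow equation of the reversed field, in integral form on the window:
`disp m (t−σ) t x = ∫₀^σ −b_{≤m}(t − r, x + proj disp m (t−r) t x) dr`. [cite: ArmstrongVicol2025, §2.2 (PDF p. 18: the flow ODE)] -/
theorem disp_backward_integral_eq (E : LagrangianLatticeCarrier k) {m : ℕ} (hF : E.IsFlow m) (t σ : ℝ) (x : UnitAddTorus (Fin 3)) :
    E.disp m (t - σ) t x = ∫ r in (0 : ℝ)..σ, -E.partialSum m (t - r) (x + proj (E.disp m (t - r) t x)) := by
  rw [hF (t - σ) t x, intervalIntegral.integral_neg]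
  have h := intervalIntegral.integral_comp_sub_left (fun r => E.partialSum m r (x + proj (E.disp m r t x))) t (a := 0) (b := σ)
  rw [sub_zero] at h
  rw [h, intervalIntegral.integral_symm]
  rfl

/-- The backward data on the window: continuity of the space–time lifts, smooth slices, time-uniform all-order bounds of the
reversed field `r ↦ −b_{≤m}(w+s−r)` and of the backward displacement `r ↦ disp m (w+s−r) (w+s)` on `[0,s]` — the last from
the group law `Φ(w+s→r) = Φ(w→r) ∘ Φ(w+s→w)` and the window bounds (F1c).
[cite: ArmstrongVicol2025, §2.2 (PDF p. 18) and §5.1; Hartman2002, Ch. V Thm. 3.1] -/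
theorem window_backward_clauses (E : LagrangianLatticeCarrier k) (hR : E.LevelRegular) {m : ℕ} (hF : E.IsFlow m) (j : ℤ)
    {s : ℝ} (hsR : s < E.refresh (m + 1)) :
    let w : ℝ := (j : ℝ) * E.refresh (m + 1)
    ContinuousOn (stLift fun r y => -E.partialSum m (w + s - r) y) (Icc 0 s ×ˢ univ) ∧
      (∀ r ∈ Icc 0 s, IsSmooth (fun y => -E.partialSum m (w + s - r) y)) ∧
      (∀ n : ℕ, ∃ C : ℝ, ∀ r ∈ Icc 0 s, ∀ y, ‖iteratedFDeriv ℝ n (lift fun y => -E.partialSum m (w + s - r) y) y‖ ≤ C) ∧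
      ContinuousOn (stLift fun r => E.disp m (w + s - r) (w + s)) (Icc 0 s ×ˢ univ) ∧
      (∀ r ∈ Icc 0 s, IsSmooth (E.disp m (w + s - r) (w + s))) ∧
      (∀ n : ℕ, ∃ C : ℝ, ∀ r ∈ Icc 0 s, ∀ y, ‖iteratedFDeriv ℝ n (lift (E.disp m (w + s - r) (w + s))) y‖ ≤ C) := by
  intro w
  obtain ⟨h1, h3a, h3b, hF1a⟩ := levelRegular_flow_args E hR
  refine ⟨?_, fun r _ => (hR.isSmooth_partialSum m _).neg, fun n => ?_, ?_, fun r _ => hR.isSmooth_disp m _ _, fun n => ?_⟩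
  · -- continuity of the reversed field
    have hc : Continuous fun p : ℝ × UnitAddTorus (Fin 3) => -E.partialSum m (w + s - p.1) p.2 :=
      ((hR.continuous_uncurry_partialSum m).comp ((continuous_const.sub continuous_fst).prodMk continuous_snd)).neg
    exact (hc.comp (continuous_fst.prodMk (continuous_proj.comp continuous_snd))).continuousOn
  · obtain ⟨C, hC⟩ := hR.exists_norm_iteratedFDeriv_partialSum_le m n
    refine ⟨C, fun r _ y => ?_⟩
    have e : (lift fun y => -E.partialSum m (w + s - r) y) = -lift (E.partialSum m (w + s - r)) := rfl
    rw [e, iteratedFDeriv_neg_apply, norm_neg]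
    exact hC _ y
  · have hc : Continuous fun p : ℝ × UnitAddTorus (Fin 3) => E.disp m (w + s - p.1) (w + s) p.2 :=
      (hR.continuous_disp m (w + s)).comp ((continuous_const.sub continuous_fst).prodMk continuous_snd)
    exact (hc.comp (continuous_fst.prodMk (continuous_proj.comp continuous_snd))).continuousOn
  · -- the group law: `lift (disp m r (w+s)) = lift (disp m r w) ∘ (id + lift (disp m w (w+s))) + lift (disp m w (w+s))`
    set B : ℝ → EuclideanSpace ℝ (Fin 3) → EuclideanSpace ℝ (Fin 3) := fun t z => E.partialSum m t (proj z) with hB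
    have hLip : IsUniformlyLipschitzOn B univ := isUniformlyLipschitzOn_partialSum_proj E h1 h3a h3b m
    have hlift : ∀ t₁ t₂, Torus.lift (E.disp m t₁ t₂) = fun z => evolutionMap B t₂ t₁ z - z := fun t₁ t₂ =>
      lift_disp_eq_evolutionMap_sub E m hF h1 h3a h3b hF1a t₁ t₂
    set G : EuclideanSpace ℝ (Fin 3) → EuclideanSpace ℝ (Fin 3) := fun z => z + lift (E.disp m w (w + s)) z with hG
    have hGeq : ∀ z, G z = evolutionMap B (w + s) w z := fun z => by
      simp only [hG, hlift w (w + s)]; abel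
    have hcomp : ∀ r, lift (E.disp m r (w + s)) = fun z => lift (E.disp m r w) (G z) + lift (E.disp m w (w + s)) z := by
      intro r; funext z
      simp only [hlift, hGeq]
      rw [hLip.evolutionMap_trans convex_univ (mem_univ _) (mem_univ _) (mem_univ _)]
      abel
    -- bounds: window bounds for `disp m (w + s') w`, fixed bounds for `G` and `disp m w (w+s)`
    obtain ⟨-, hDs, hDB⟩ := hR.window_disp_clauses m j hsR
    have hGs : IsSmooth (E.disp m w (w + s)) := hR.isSmooth_disp m _ _
    -- uniform constants up to order `n`
    have hunifD : ∃ C : ℝ, 0 ≤ C ∧ ∀ i, i ≤ n → ∀ p : {p : ℝ × EuclideanSpace ℝ (Fin 3) // p.1 ∈ Icc 0 s},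
        ‖iteratedFDeriv ℝ i (lift (E.disp m (w + p.1.1) w)) p.1.2‖ ≤ C :=
      exists_uniform_bound_le (P := fun (p : {p : ℝ × EuclideanSpace ℝ (Fin 3) // p.1 ∈ Icc 0 s}) i =>
        ‖iteratedFDeriv ℝ i (lift (E.disp m (w + p.1.1) w)) p.1.2‖) 0
        (fun i => by obtain ⟨C, hC⟩ := hDB i; exact ⟨C, fun p => hC p.1.1 p.2 p.1.2⟩) n
    have hunifG : ∃ K : ℝ, 1 ≤ K ∧ ∀ i, i ≤ n → ∀ y : EuclideanSpace ℝ (Fin 3),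
        ‖iteratedFDeriv ℝ i (lift (E.disp m w (w + s))) y‖ ≤ K :=
      exists_uniform_bound_le (P := fun (y : EuclideanSpace ℝ (Fin 3)) i => ‖iteratedFDeriv ℝ i (lift (E.disp m w (w + s))) y‖) 1
        (fun i => by obtain ⟨C, _, hC⟩ := exists_bound_iteratedFDeriv_lift hGs i; exact ⟨C, hC⟩) n
    obtain ⟨CD, hCD0, hCD⟩ := hunifD
    obtain ⟨K, hK1, hK⟩ := hunifG
    refine ⟨(Nat.factorial n : ℝ) * CD * (1 + K) ^ n + K, fun r hr y => ?_⟩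
    have hs' : s - r ∈ Icc 0 s := ⟨by linarith [hr.2], by linarith [hr.1]⟩
    have hws : w + s - r = w + (s - r) := by ring
    rw [hws, hcomp (w + (s - r))]
    have hg : ContDiff ℝ n (lift (E.disp m (w + (s - r)) w)) := (hDs (s - r) hs').of_le (by exact_mod_cast le_top)
    have hGc : ContDiff ℝ n G := (contDiff_id.add hGs).of_le (by exact_mod_cast le_top)
    have hK' : ContDiff ℝ n (lift (E.disp m w (w + s))) := hGs.of_le (by exact_mod_cast le_top)
    show ‖iteratedFDeriv ℝ n ((lift (E.disp m (w + (s - r)) w) ∘ G) + lift (E.disp m w (w + s))) y‖ ≤ _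
    rw [iteratedFDeriv_add_apply (hg.comp hGc).contDiffAt hK'.contDiffAt]
    refine (norm_add_le _ _).trans (add_le_add ?_ (hK n le_rfl y))
    refine norm_iteratedFDeriv_comp_le hg hGc le_rfl y (fun i hi => hCD i hi ⟨(s - r, _), hs'⟩) fun i hi1 hin => ?_
    -- `‖Dⁱ G‖ ≤ 1 + ‖Dⁱ lift(disp m w (w+s))‖ ≤ 1 + K ≤ (1+K)^i`
    have hid : ContDiff ℝ ∞ (fun z : EuclideanSpace ℝ (Fin 3) => z) := contDiff_id
    have hEc : ContDiff ℝ ∞ (lift (E.disp m w (w + s))) := hGs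
    have e1 : iteratedFDeriv ℝ i G y = iteratedFDeriv ℝ i (fun z : EuclideanSpace ℝ (Fin 3) => z) y +
        iteratedFDeriv ℝ i (lift (E.disp m w (w + s))) y :=
      iteratedFDeriv_add_apply (hid.contDiffAt.of_le (by exact_mod_cast le_top)) (hEc.contDiffAt.of_le (by exact_mod_cast le_top))
    rw [e1]
    have hidle : ‖iteratedFDeriv ℝ i (fun z : EuclideanSpace ℝ (Fin 3) => z) y‖ ≤ 1 := by
      obtain ⟨i, rfl⟩ := Nat.exists_eq_add_of_le' hi1
      rw [← norm_iteratedFDeriv_fderiv]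
      have hf : _root_.fderiv ℝ (fun z : EuclideanSpace ℝ (Fin 3) => z) = fun _ => ContinuousLinearMap.id ℝ _ := by
        funext z; exact fderiv_id
      rw [hf]
      rcases Nat.eq_zero_or_pos i with rfl | hi0
      · rw [norm_iteratedFDeriv_zero]; exact ContinuousLinearMap.norm_id_le
      · rw [iteratedFDeriv_const_of_ne (Nat.pos_iff_ne_zero.mp hi0)]
        simp only [Pi.zero_apply, norm_zero]
        exact zero_le_one
    calc ‖iteratedFDeriv ℝ i (fun z : EuclideanSpace ℝ (Fin 3) => z) y + iteratedFDeriv ℝ i (lift (E.disp m w (w + s))) y‖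
        ≤ 1 + K := (norm_add_le _ _).trans (add_le_add hidle (hK i hin y))
      _ ≤ (1 + K) ^ i := by
          calc (1 : ℝ) + K = (1 + K) ^ 1 := (pow_one _).symm
            _ ≤ (1 + K) ^ i := pow_le_pow_right₀ (by linarith) hi1

/-- **Backward window flow, analyticity of the inverse Jacobian entries**: under the same seminorm bounds of `b_{≤m}` and the
same window condition `s ≤ 1/(12 C_f R_f)`, the inverse displacement `Dinv = disp m w (w+s)` (`X_m(w, w+s) = id + proj ∘ Dinv`)
satisfies `⟦δ_{ac} + ∂_c Dinv_a⟧_{n, 24 R_f (1 + 24 C_f R_f s)} ≤ 18` for `1 ≤ n ≤ N − 1`.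
[cite: ArmstrongVicol2025, App. A Prop. 7.11 and Prop. 7.10 (the inverse flow); §2.2 (PDF p. 18)] -/
theorem dnorm_dispInv_entry_le (E : LagrangianLatticeCarrier k) (hR : E.LevelRegular) {m : ℕ} (hF : E.IsFlow m)
    (j : ℤ) {Cf Rf : ℝ} (hCf : 0 < Cf) (hRf : 0 < Rf) {N : ℕ}
    (hfb : ∀ n, 1 ≤ n → n ≤ N → ∀ t, dnorm n Rf (E.partialSum m t) ≤ Cf)
    {s : ℝ} (hs0 : 0 ≤ s) (hsR : s < E.refresh (m + 1)) (hsT : s ≤ 1 / (12 * Cf * Rf)) :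
    ∀ n, 1 ≤ n → n + 1 ≤ N → ∀ a c : Fin 3,
      dnorm n (24 * Rf * (1 + 24 * Cf * Rf * s))
        (fun y => (1 : Matrix (Fin 3) (Fin 3) ℝ) a c +
          partialDeriv c (fun z => E.disp m ((j : ℝ) * E.refresh (m + 1)) ((j : ℝ) * E.refresh (m + 1) + s) z a) y) ≤ 18 := by
  intro n hn1 hnN a c
  set w : ℝ := (j : ℝ) * E.refresh (m + 1) with hw
  obtain ⟨hbc, hbs, hbB, hDc, hDs, hDB⟩ := window_backward_clauses E hR hF j hsR
  have hint : ∀ σ ∈ Icc 0 s, ∀ x, E.disp m (w + s - σ) (w + s) x =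
      ∫ r in (0 : ℝ)..σ, -E.partialSum m (w + s - r) (x + proj (E.disp m (w + s - r) (w + s) x)) :=
    fun σ _ x => disp_backward_integral_eq E hF (w + s) σ x
  have hDt := hasDerivWithinAt_iterPartialDeriv_disp (b := fun r y => -E.partialSum m (w + s - r) y)
    (D := fun r => E.disp m (w + s - r) (w + s)) hbc hbs hbB hDc hDs hDB hint
  have hT₀ : s ≤ 1 / (4 * (Fintype.card (Fin 3) : ℝ) * Cf * Rf) := by
    have e4 : (4 : ℝ) * (Fintype.card (Fin 3) : ℝ) * Cf * Rf = 12 * Cf * Rf := by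
      rw [Fintype.card_fin]; push_cast; ring
    rw [e4]; exact hsT
  have hfb' : ∀ n, 1 ≤ n → n ≤ N → ∀ r, dnorm n Rf (fun y => -E.partialSum m (w + s - r) y) ≤ Cf := by
    intro n hn hnN r
    rw [dnorm_neg]; exact hfb n hn hnN _
  have key := dnorm_flowGrad_le_forward_ofDerivWithin (f := fun r y => -E.partialSum m (w + s - r) y)
    (D := fun r => E.disp m (w + s - r) (w + s)) hCf hRf (fun r => (hR.isSmooth_partialSum m _).neg)
    (fun r => hR.isSmooth_disp m _ _) (fun x => by simpa using disp_self_of_isFlow E hF (w + s) x) hT₀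
    (fun l i x t ht => hDt l i x ht) hfb' n hn1 hnN s ⟨hs0, le_rfl⟩ a c
  have e : (24 : ℝ) * Rf * (1 + 24 * Cf * Rf * s) =
      8 * (Fintype.card (Fin 3) : ℝ) * Rf * (1 + 8 * (Fintype.card (Fin 3) : ℝ) * Cf * Rf * s) := by
    rw [Fintype.card_fin]; norm_num
  rw [e]
  simp only [add_sub_cancel_right] at key
  refine key.trans ?_
  rw [Fintype.card_fin]; norm_num

/-- **Backward window flow, first-order distortion**: `|∂_c (disp m w (w+s))_a (y)| ≤ 24 C_f R_f s`.
[cite: ArmstrongVicol2025, App. A Prop. 7.10 (first display); §2.2 (PDF p. 18)] -/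
theorem abs_partialDeriv_dispInv_le (E : LagrangianLatticeCarrier k) (hR : E.LevelRegular) {m : ℕ} (hF : E.IsFlow m)
    (j : ℤ) {Cf Rf : ℝ} (hCf : 0 < Cf) (hRf : 0 < Rf) {N : ℕ} (hN : 1 ≤ N)
    (hfb : ∀ n, 1 ≤ n → n ≤ N → ∀ t, dnorm n Rf (E.partialSum m t) ≤ Cf)
    {s : ℝ} (hs0 : 0 ≤ s) (hsR : s < E.refresh (m + 1)) (hsT : s ≤ 1 / (12 * Cf * Rf)) (c a : Fin 3) (y : UnitAddTorus (Fin 3)) :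
    |partialDeriv c (fun z => E.disp m ((j : ℝ) * E.refresh (m + 1)) ((j : ℝ) * E.refresh (m + 1) + s) z a) y| ≤
      24 * Cf * Rf * s := by
  set w : ℝ := (j : ℝ) * E.refresh (m + 1) with hw
  obtain ⟨hbc, hbs, hbB, hDc, hDs, hDB⟩ := window_backward_clauses E hR hF j hsR
  have hint : ∀ σ ∈ Icc 0 s, ∀ x, E.disp m (w + s - σ) (w + s) x =
      ∫ r in (0 : ℝ)..σ, -E.partialSum m (w + s - r) (x + proj (E.disp m (w + s - r) (w + s) x)) :=
    fun σ _ x => disp_backward_integral_eq E hF (w + s) σ x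
  have hDt := hasDerivWithinAt_iterPartialDeriv_disp (b := fun r y => -E.partialSum m (w + s - r) y)
    (D := fun r => E.disp m (w + s - r) (w + s)) hbc hbs hbB hDc hDs hDB hint
  have hT₀ : s ≤ 1 / (4 * (Fintype.card (Fin 3) : ℝ) * Cf * Rf) := by
    have e4 : (4 : ℝ) * (Fintype.card (Fin 3) : ℝ) * Cf * Rf = 12 * Cf * Rf := by
      rw [Fintype.card_fin]; push_cast; ring
    rw [e4]; exact hsT
  have hfb' : ∀ n, 1 ≤ n → n ≤ N → ∀ r, dnorm n Rf (fun y => -E.partialSum m (w + s - r) y) ≤ Cf := by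
    intro n hn hnN r
    rw [dnorm_neg]; exact hfb n hn hnN _
  have key := abs_partialDeriv_disp_le_forward_ofDerivWithin (f := fun r y => -E.partialSum m (w + s - r) y)
    (D := fun r => E.disp m (w + s - r) (w + s)) hCf hRf hN (fun r => (hR.isSmooth_partialSum m _).neg)
    (fun r => hR.isSmooth_disp m _ _) (fun x => by simpa using disp_self_of_isFlow E hF (w + s) x) hT₀
    (fun l i x t ht => hDt l i x ht) hfb' (t := s) ⟨hs0, le_rfl⟩ c a y
  simp only [add_sub_cancel_right] at key
  refine key.trans (le_of_eq ?_)
  rw [Fintype.card_fin]; norm_num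

end Summit.AnomalousDissipation.AnomalousDissipation.Theorems.SolenoidalFractalHomogenisation.LagrangianCarrierAnalytic

end
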